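import Literature.AlgebraicGeometry.Motives.HodgeStructureCentralizerCenterFactorsFieldExtension
import Literature.AlgebraicGeometry.Motives.HodgeStructureLefschetzGroupCenterFieldExtension
import Literature.AlgebraicGeometry.Motives.HodgeStructureLefschetzGroupCenterPointsEigenblocks
import Literature.AlgebraicGeometry.Motives.EtaleTate
import HarnessLib

/-!
# `γ ↦ γ_L` IS FUNCTORIAL IN THE COEFFICIENT FIELD AND CARRIES EIGENBLOCKS TO EIGENBLOCKS: `(γ_L)_M = γ_M`, `γ_K = γ`, `(g_K)_L = g_L`;
# `dim_L span_L j(W) = dim_K W`, `ker F = span_L j(ker f)`, `V_μ(γ_L) = span_L j(V_μ(γ))`; THE SIGN BLOCKS OF A CENTRAL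
# `γ ∈ S(H)(K)` BASE-CHANGE TO THOSE OF `γ_L` AND STILL SPLIT `L ⊗ V` (Milne 1999 §1 Remark 1.6 «`S'(A) ≅ S(A)_{/k'}`», §2 p. 646
# «`V(A) = V₁ ⊕ ⋯ ⊕ V_t` … any `k`-linear `α` commuting with `F` decomposes `α = α₁ ⊕ ⋯ ⊕ α_t`»)

[topic AlgebraicGeometry/Motives]

Layer `Literature/AlgebraicGeometry/Motives`, lane `lit-hodgefound` (Track 2 foundations library; prover seat
`lit-hodgefound-p02`, generation 56, self-proposed row g56-#5). THEOREMS ONLY: no definition, no named fact (net debt `0`),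
no instance, no notation.  Two complements to g56-#1…#4 (the centre, the factors and the involution of `C(A) ⊗ k` and the centre
of `S(A)` along `k ⊆ k'`).  FIRST, Remark 1.6 «`S'(A) ≅ S(A)_{/k'}`» read through points is a statement about the FUNCTOR
`R ↦ S(A)(R)`; the tree's maps `γ ↦ γ_L` (`glExtendScalars`, `Motives/MumfordTateGroupFieldExtension`) and `g ↦ g_K` (`glBaseChange`,
`Motives/EtaleTate`) are shown to compose as a functor should: `(γ_L)_M = γ_M` in a tower `K ⊆ L ⊆ M`, `γ_K = γ` for `K = L`, and
`(g_K)_L = g_L` (the tree's `glExtendScalars_glBaseChange`, here as monoid homomorphisms) — so the embeddings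
`Z(S(H)(ℚ)) ↪ Z(S(H)(K)) ↪ Z(S(H)(L))` of g54-#10 ∕ g56-#2 are compatible.  SECOND, the blocks: `L` is free, hence flat, over `K`,
so for a `K`-subspace `W ⊆ K ⊗ V` the `L`-span of `j(W)` has `L`-dimension `dim_K W` (`L ⊗_K W ↪ L ⊗_K (K ⊗ V) ≅ L ⊗ V`), whence
for the `L`-extension `F` of `f` (g56-#1: `F ∘ j = j ∘ f`) not only `F(L ⊗ V) = span_L j(f(K ⊗ V))` (g56-#3) but also
**`ker F = span_L j(ker f)`** (rank–nullity over `K` and over `L`), and **`V_μ(γ_L) = span_L j(V_μ(γ))`** for every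
`γ ∈ GL(K ⊗ V)`, `μ ∈ K` — Milne's decomposition `α = α₁ ⊕ ⋯ ⊕ α_t` of a map commuting with `F` is compatible with `k ⊆ k'`.  For a
central `γ ∈ S(H)(K)` (which acts on the canonical blocks by signs, g55-#1 ∕ #12) the sign blocks `V_±(γ)` thus base-change to
`V_±(γ_L)`, `γ_L` central in `S(H)(L)` (g56-#2), and for `†` of the first kind `L ⊗ V = V₊(γ_L) ⊕ V₋(γ_L)` (g55-#12 over `L`).

## The sources, verbatim

* J. S. Milne, *Lefschetz classes on abelian varieties*, Duke Math. J. 96 (1999) 639–675 [Milne1999LefschetzClasses] (held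
  `paper:doi-10-1215-s0012-7094-99-09620-5`): folio 6 = p. 644 L16–L20 «`S(A)(R) = {γ ∈ C(A) ⊗_k R | γ†γ = 1}` for all commutative
  `k`-algebras `R`», L30–L37 «**Remark 1.6.** … `C'(A) ≅ C(A) ⊗_k k'`, `S'(A) ≅ S(A)_{/k'}`»; folio 7 = p. 645 L2–L6 (`C₀`, `S₀`);
  folio 8 = p. 646 L33–L40 «`F ⊗_ℚ k = F₁ × ⋯ × F_t` … `V(A) = V₁ ⊕ ⋯ ⊕ V_t`, `V_i = e_i V` … Any `k`-linear map `α : V → V`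
  commuting with the action of `F` decomposes into `α = α₁ ⊕ ⋯ ⊕ α_t`, `α_i : V_i → V_i`».
* B. J. J. Moonen, Yu. G. Zarhin, *Weil classes on abelian varieties* [MoonenZarhin1998WeilClasses], §1 Lemma (1) (the centre `U_{K_B}`).
* P. Deligne, *Hodge cycles on abelian varieties*, LNM 900 (1982) [Deligne1982HodgeCycles], I §3.1 (groups through their functor of points).
* N. Bourbaki, *Algebra I* [BourbakiAlgebraI1989], Ch. II §5 no. 1 Prop. 2 (transitivity of extension of scalars), no. 3 Prop. 7
  (faithful flatness over a field), §7 no. 7.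

Nearest tree results, BY NAME: `glExtendScalars_extendScalars`, `glExtendScalarsHom` (`Motives/MumfordTateGroupFieldExtension`), `glBaseChange`
(`Motives/EtaleTate`), `glExtendScalars_glBaseChange` (`Motives/HodgeGroupIsotropyIffCM`, elementwise `(g_K)_L = g_L`); g56-#1
`linearMap_ext_of_extendScalars` ∕ `linearMap_eq_of_extendScalars_comm` ∕ `extendScalars_smul_eq_algebraMap_smul`; g56-#2
`coe_glExtendScalars_extendScalars`, `Polarization.glExtendScalars_mem_center_lefschetzGroupBaseChange`; g56-#3
`range_eq_span_image_extendScalars_of_extendScalars_comm`, `span_image_extendScalars_ker_le_of_extendScalars_comm` (kernels of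
IDEMPOTENTS only); g55-#12 `Polarization.isCompl_eigenspace_one_neg_one_of_mem_center_lefschetzGroupBaseChange`; g54-#6
`finrank_span_image_baseChange_eq` (the same dimension count for base-changed ENDOMORPHISMS `ℚ → K`).

## Dictionary and what is proved

`j = j_{K→L} = extendScalars K L V`, `γ_L = glExtendScalars K L V γ`, `g_K = glBaseChange K V g`, `V_μ(f) = Module.End.eigenspace f μ`;
"`F` extends `f`" = `∀ x, F (j x) = j (f x)`.

* §1 functoriality (namespace `…Motives`): **`extendScalars_extendScalars_tower`** (`j_{L→M} ∘ j_{K→L} = j_{K→M}`),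
  **`glExtendScalars_glExtendScalars`** (`(γ_L)_M = γ_M`), `glExtendScalarsHom_comp_glExtendScalarsHom`, **`extendScalars_self`**,
  **`glExtendScalars_self`** (`γ_K = γ`), **`glExtendScalarsHom_comp_glBaseChange`** (`(g_K)_L = g_L` as homs).
* §2 kernels (namespace `…Motives`): `cancelBaseChange_tmul_eq_smul_extendScalars`, **`finrank_span_image_extendScalars_eq`**
  (`dim_L span_L j(W) = dim_K W`), **`ker_eq_span_image_extendScalars_of_extendScalars_comm`** (`ker F = span_L j(ker f)`),
  `sub_algebraMap_smul_extendScalars_comm`, **`eigenspace_eq_span_image_extendScalars_of_extendScalars_comm`**,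
  **`eigenspace_glExtendScalars_eq_span_image_extendScalars`** (`V_μ(γ_L) = span_L j(V_μ(γ))`), **`eigenspace_glExtendScalars_one_neg_one`**,
  **`extendScalars_mem_eigenspace_glExtendScalars_iff`** (`j x ∈ V_μ(γ_L) ⟺ x ∈ V_μ(γ)`).
* §3 (namespace `…Motives.HodgeStructure`) **`Polarization.eigenspace_glExtendScalars_one_neg_one_eq_span`**,
  **`Polarization.isCompl_span_image_extendScalars_eigenspace_of_mem_center`** (first kind, central `γ`:
  `L ⊗ V = span_L j(V₊(γ)) ⊕ span_L j(V₋(γ))`).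
-/

noncomputable section

open scoped TensorProduct

namespace Literature.AlgebraicGeometry.Motives

universe u u' u'' v

/-! ## §1 Functoriality of `γ ↦ γ_L`: `(γ_L)_M = γ_M`, `γ_K = γ` over `K` itself, `(g_K)_L = g_L` for rational `g` -/

section Functoriality

variable (K : Type u) (L : Type u') (M : Type u'') [Field K] [Field L] [Field M] [Algebra ℚ K] [Algebra ℚ L] [Algebra ℚ M]
  [Algebra K L] [Algebra L M] [Algebra K M] [IsScalarTower ℚ K L] [IsScalarTower ℚ L M] [IsScalarTower ℚ K M]
  [IsScalarTower K L M] (V : Type v) [AddCommGroup V] [Module ℚ V]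

/-- **`j_{L→M} ∘ j_{K→L} = j_{K→M}`** (transitivity of extension of scalars in a tower `K ⊆ L ⊆ M`). [cite: BourbakiAlgebraI1989, Ch. II §5 no. 1 Prop. 2] -/
theorem extendScalars_extendScalars_tower (x : K ⊗[ℚ] V) :
    extendScalars L M V (extendScalars K L V x) = extendScalars K M V x := by
  induction x using TensorProduct.induction_on with
  | zero => simp only [map_zero]
  | tmul c v => rw [extendScalars_tmul, extendScalars_tmul, extendScalars_tmul, ← IsScalarTower.algebraMap_apply]
  | add x y hx hy => rw [map_add, map_add, hx, hy, map_add]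

/-- **`(γ_L)_M = γ_M`**: extending scalars in two steps `K → L → M` or in one step `K → M` gives the same automorphism of `M ⊗ V` —
the functor of points `R ↦ S(A)(R)` composes («`S'(A) ≅ S(A)_{/k'}`» is transitive in `k ⊆ k' ⊆ k''`).
[cite: Milne1999LefschetzClasses, §1 Remark 1.6 (p. 644)] [cite: Deligne1982HodgeCycles, I §3.1] -/
theorem glExtendScalars_glExtendScalars (γ : (K ⊗[ℚ] V) ≃ₗ[K] (K ⊗[ℚ] V)) :
    glExtendScalars L M V (glExtendScalars K L V γ) = glExtendScalars K M V γ := by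
  refine LinearEquiv.toLinearMap_injective (linearMap_ext_of_extendScalars K M V fun x => ?_)
  rw [LinearEquiv.coe_coe, LinearEquiv.coe_coe, glExtendScalars_extendScalars K M V γ x, ← extendScalars_extendScalars_tower K L M V x,
    glExtendScalars_extendScalars L M V, glExtendScalars_extendScalars K L V, extendScalars_extendScalars_tower]

/-- The monoid-hom spelling: `glExtendScalarsHom L M ∘ glExtendScalarsHom K L = glExtendScalarsHom K M`. [cite: Milne1999LefschetzClasses, §1 Remark 1.6 (p. 644)] -/
theorem glExtendScalarsHom_comp_glExtendScalarsHom :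
    (glExtendScalarsHom L M V).comp (glExtendScalarsHom K L V) = glExtendScalarsHom K M V :=
  MonoidHom.ext fun γ => glExtendScalars_glExtendScalars K L M V γ

end Functoriality

section Identity

variable (K : Type u) [Field K] [Algebra ℚ K] (V : Type v) [AddCommGroup V] [Module ℚ V]

/-- `j_{K→K} = id`. [cite: BourbakiAlgebraI1989, Ch. II §5 no. 1] -/
theorem extendScalars_self (x : K ⊗[ℚ] V) : extendScalars K K V x = x := by
  induction x using TensorProduct.induction_on with
  | zero => simp only [map_zero]
  | tmul c v => rw [extendScalars_tmul]; rfl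
  | add x y hx hy => rw [map_add, hx, hy]

/-- **`γ_K = γ` over `K` itself** (the functor of points at the identity `K → K`). [cite: Milne1999LefschetzClasses, §1 Remark 1.6 (p. 644)] -/
theorem glExtendScalars_self (γ : (K ⊗[ℚ] V) ≃ₗ[K] (K ⊗[ℚ] V)) : glExtendScalars K K V γ = γ := by
  refine LinearEquiv.toLinearMap_injective (linearMap_ext_of_extendScalars K K V fun x => ?_)
  rw [LinearEquiv.coe_coe, LinearEquiv.coe_coe, glExtendScalars_extendScalars, extendScalars_self, extendScalars_self]

end Identity

section Rational

variable (K : Type u) (L : Type u') [Field K] [Field L] [Algebra ℚ K] [Algebra ℚ L] [Algebra K L]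
  [IsScalarTower ℚ K L] (V : Type v) [AddCommGroup V] [Module ℚ V]

/-- **`(g_K)_L = g_L` FOR RATIONAL `g ∈ GL(V)`, AS MONOID HOMS: `glExtendScalarsHom K L ∘ glBaseChange K = glBaseChange L`** (the tree's
`glExtendScalars_glBaseChange`, `Motives/HodgeGroupIsotropyIffCM`, elementwise): the embeddings `S(H)(ℚ) ↪ S(H)(K) ↪ S(H)(L)` of g54-#10
and g56-#2 compose to `S(H)(ℚ) ↪ S(H)(L)`. [cite: Milne1999LefschetzClasses, §1 Remark 1.6 (p. 644)] [cite: Deligne1982HodgeCycles, I §3.1] -/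
theorem glExtendScalarsHom_comp_glBaseChange :
    (glExtendScalarsHom K L V).comp (glBaseChange K V) = glBaseChange L V :=
  MonoidHom.ext fun g => glExtendScalars_glBaseChange K L g

end Rational

/-! ## §2 Kernels and eigenspaces along `j` (`L` is flat over `K`): `dim_L span_L j(W) = dim_K W`, `ker F = span_L j(ker f)`,
`V_μ(γ_L) = span_L j(V_μ(γ))` -/

section Kernels

variable (K : Type u) (L : Type u') [Field K] [Field L] [Algebra ℚ K] [Algebra ℚ L] [Algebra K L]
  [IsScalarTower ℚ K L] (V : Type v) [AddCommGroup V] [Module ℚ V]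

/-- `cancel (l ⊗ₜ[K] y) = l • j y` for the canonical `L ⊗_K (K ⊗_ℚ V) ≅ L ⊗_ℚ V`. [cite: BourbakiAlgebraI1989, Ch. II §7 no. 7] -/
theorem cancelBaseChange_tmul_eq_smul_extendScalars (l : L) (y : K ⊗[ℚ] V) :
    TensorProduct.AlgebraTensorModule.cancelBaseChange ℚ K L L V (l ⊗ₜ[K] y) = l • extendScalars K L V y := by
  induction y using TensorProduct.induction_on with
  | zero => simp
  | tmul c v =>
    rw [TensorProduct.AlgebraTensorModule.cancelBaseChange_tmul, extendScalars_tmul, TensorProduct.smul_tmul', Algebra.smul_def, smul_eq_mul,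
      mul_comm]
  | add y₁ y₂ h₁ h₂ => rw [TensorProduct.tmul_add, map_add, h₁, h₂, map_add, smul_add]

/-- **`dim_L span_L j(W) = dim_K W` FOR EVERY `K`-SUBSPACE `W ⊆ K ⊗ V`** (`L` is free, hence flat, over `K`: `L ⊗_K W ↪ L ⊗_K (K ⊗ V) ≅
L ⊗ V` has image `span_L j(W)`). [cite: BourbakiAlgebraI1989, Ch. II §7 no. 7 and §5 no. 3 Prop. 7] -/
theorem finrank_span_image_extendScalars_eq (W : Submodule K (K ⊗[ℚ] V)) :
    Module.finrank L (Submodule.span L (extendScalars K L V '' (W : Set (K ⊗[ℚ] V)))) = Module.finrank K W := by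
  haveI : Module.Free K L := Module.Free.of_divisionRing K L
  haveI : Module.Free K W := Module.Free.of_divisionRing K W
  let Φ : L ⊗[K] W →ₗ[L] L ⊗[ℚ] V :=
    (TensorProduct.AlgebraTensorModule.cancelBaseChange ℚ K L L V).toLinearMap ∘ₗ W.subtype.baseChange L
  have hΦ : ∀ (l : L) (w : W), Φ (l ⊗ₜ[K] w) = l • extendScalars K L V w := fun l w => by
    simp only [Φ, LinearMap.comp_apply, LinearMap.baseChange_tmul, LinearEquiv.coe_toLinearMap, Submodule.subtype_apply]
    exact cancelBaseChange_tmul_eq_smul_extendScalars K L V l w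
  have hinj : Function.Injective Φ := by
    refine (TensorProduct.AlgebraTensorModule.cancelBaseChange ℚ K L L V).injective.comp ?_
    change Function.Injective (W.subtype.baseChange L : L ⊗[K] W → L ⊗[K] (K ⊗[ℚ] V))
    rw [LinearMap.baseChange_eq_ltensor]
    exact Module.Flat.lTensor_preserves_injective_linearMap W.subtype W.injective_subtype
  have hrange : LinearMap.range Φ = Submodule.span L (extendScalars K L V '' (W : Set (K ⊗[ℚ] V))) := by
    refine le_antisymm ?_ (Submodule.span_le.2 ?_)
    · rintro _ ⟨t, rfl⟩
      induction t using TensorProduct.induction_on with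
      | zero => rw [map_zero]; exact Submodule.zero_mem _
      | tmul l w => rw [hΦ]; exact Submodule.smul_mem _ _ (Submodule.subset_span ⟨w, w.2, rfl⟩)
      | add x y hx hy => rw [map_add]; exact Submodule.add_mem _ hx hy
    · rintro _ ⟨w, hw, rfl⟩
      refine ⟨(1 : L) ⊗ₜ[K] ⟨w, hw⟩, ?_⟩
      rw [hΦ, one_smul]
  rw [← hrange, LinearMap.finrank_range_of_inj hinj, Module.finrank_baseChange]

variable [Module.Finite ℚ V]

/-- **THE KERNEL OF THE `L`-EXTENSION `F` OF `f` IS THE `L`-SPAN OF `j(ker f)`** (finite-dimensional `V`): `span_L j(ker f) ⊆ ker F`, and both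
have dimension `dim_K ker f` (rank–nullity over `K` and over `L`, `F(L ⊗ V) = span_L j(f(K ⊗ V))`). [cite: BourbakiAlgebraI1989, Ch. II §7 no. 7 and §5 no. 3 Prop. 7] -/
theorem ker_eq_span_image_extendScalars_of_extendScalars_comm {f : Module.End K (K ⊗[ℚ] V)} {F : Module.End L (L ⊗[ℚ] V)}
    (hF : ∀ x, F (extendScalars K L V x) = extendScalars K L V (f x)) :
    LinearMap.ker F = Submodule.span L (extendScalars K L V '' (LinearMap.ker f : Set (K ⊗[ℚ] V))) := by
  refine (Submodule.eq_of_le_of_finrank_eq (span_image_extendScalars_ker_le_of_extendScalars_comm K L V hF) ?_).symm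
  have hL := LinearMap.finrank_range_add_finrank_ker F
  have hK := LinearMap.finrank_range_add_finrank_ker f
  rw [range_eq_span_image_extendScalars_of_extendScalars_comm K L V hF, finrank_span_image_extendScalars_eq,
    Module.finrank_baseChange] at hL
  rw [Module.finrank_baseChange] at hK
  rw [finrank_span_image_extendScalars_eq]
  omega

omit [Module.Finite ℚ V] in
/-- `F − (K → L)(μ)` extends `f − μ`. [cite: BourbakiAlgebraI1989, Ch. II §5 no. 1] -/
theorem sub_algebraMap_smul_extendScalars_comm {f : Module.End K (K ⊗[ℚ] V)} {F : Module.End L (L ⊗[ℚ] V)}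
    (hF : ∀ x, F (extendScalars K L V x) = extendScalars K L V (f x)) (μ : K) (x : K ⊗[ℚ] V) :
    (F - algebraMap K L μ • (1 : Module.End L (L ⊗[ℚ] V))) (extendScalars K L V x) =
      extendScalars K L V ((f - μ • (1 : Module.End K (K ⊗[ℚ] V))) x) := by
  rw [LinearMap.sub_apply, LinearMap.sub_apply, LinearMap.smul_apply, LinearMap.smul_apply, Module.End.one_apply,
    Module.End.one_apply, map_sub, hF, extendScalars_smul_eq_algebraMap_smul]

omit [Module.Finite ℚ V] in
/-- `V_μ(f) = ker (f − μ)` spelled with `μ • 1`. [folklore] -/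
private theorem eigenspace_eq_ker_sub_smul_one₅₆₄ {R : Type*} [CommRing R] {N : Type*} [AddCommGroup N] [Module R N]
    (f : Module.End R N) (μ : R) : Module.End.eigenspace f μ = LinearMap.ker (f - μ • (1 : Module.End R N)) := by
  ext x
  rw [Module.End.mem_eigenspace_iff, LinearMap.mem_ker, LinearMap.sub_apply, LinearMap.smul_apply, Module.End.one_apply,
    sub_eq_zero]

/-- **EIGENSPACES ALONG `j`: `V_{μ}(F) = span_L j(V_μ(f))`** for the `L`-extension `F` of `f` and `μ ∈ K` (read in `L`). Milne's «any
`k`-linear map `α` commuting with the action of `F` decomposes into `α = α₁ ⊕ ⋯ ⊕ α_t`»: the blocks and eigenblocks of `α` base-change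
to those of `α ⊗ 1`. [cite: BourbakiAlgebraI1989, Ch. II §7 no. 7] [cite: Milne1999LefschetzClasses, §1 Remark 1.6 (p. 644) and §2 p. 646 L38–L40] -/
theorem eigenspace_eq_span_image_extendScalars_of_extendScalars_comm {f : Module.End K (K ⊗[ℚ] V)}
    {F : Module.End L (L ⊗[ℚ] V)} (hF : ∀ x, F (extendScalars K L V x) = extendScalars K L V (f x)) (μ : K) :
    Module.End.eigenspace F (algebraMap K L μ) =
      Submodule.span L (extendScalars K L V '' (Module.End.eigenspace f μ : Set (K ⊗[ℚ] V))) := by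
  rw [eigenspace_eq_ker_sub_smul_one₅₆₄, eigenspace_eq_ker_sub_smul_one₅₆₄]
  exact ker_eq_span_image_extendScalars_of_extendScalars_comm K L V (sub_algebraMap_smul_extendScalars_comm K L V hF μ)

/-- **`V_μ(γ_L) = span_L j(V_μ(γ))` FOR `γ ∈ GL(K ⊗ V)`**, `μ ∈ K`. [cite: Milne1999LefschetzClasses, §1 Remark 1.6 (p. 644) and §2 p. 646 L38–L40] -/
theorem eigenspace_glExtendScalars_eq_span_image_extendScalars (γ : (K ⊗[ℚ] V) ≃ₗ[K] (K ⊗[ℚ] V)) (μ : K) :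
    Module.End.eigenspace ((glExtendScalars K L V γ : (L ⊗[ℚ] V) ≃ₗ[L] (L ⊗[ℚ] V)) : Module.End L (L ⊗[ℚ] V))
        (algebraMap K L μ) =
      Submodule.span L (extendScalars K L V ''
        (Module.End.eigenspace ((γ : (K ⊗[ℚ] V) ≃ₗ[K] (K ⊗[ℚ] V)) : Module.End K (K ⊗[ℚ] V)) μ : Set (K ⊗[ℚ] V))) :=
  eigenspace_eq_span_image_extendScalars_of_extendScalars_comm K L V (coe_glExtendScalars_extendScalars K L V γ) μ

/-- **`V₊(γ_L) = span_L j(V₊(γ))` and `V₋(γ_L) = span_L j(V₋(γ))`** (`μ = ±1`): the sign blocks of an involution base-change.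
[cite: Milne1999LefschetzClasses, §1 Remark 1.6 (p. 644) and §2 p. 646 L33–L40] -/
theorem eigenspace_glExtendScalars_one_neg_one (γ : (K ⊗[ℚ] V) ≃ₗ[K] (K ⊗[ℚ] V)) :
    Module.End.eigenspace ((glExtendScalars K L V γ : (L ⊗[ℚ] V) ≃ₗ[L] (L ⊗[ℚ] V)) : Module.End L (L ⊗[ℚ] V)) 1 =
        Submodule.span L (extendScalars K L V ''
          (Module.End.eigenspace ((γ : (K ⊗[ℚ] V) ≃ₗ[K] (K ⊗[ℚ] V)) : Module.End K (K ⊗[ℚ] V)) 1 : Set (K ⊗[ℚ] V))) ∧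
      Module.End.eigenspace ((glExtendScalars K L V γ : (L ⊗[ℚ] V) ≃ₗ[L] (L ⊗[ℚ] V)) : Module.End L (L ⊗[ℚ] V)) (-1) =
        Submodule.span L (extendScalars K L V ''
          (Module.End.eigenspace ((γ : (K ⊗[ℚ] V) ≃ₗ[K] (K ⊗[ℚ] V)) : Module.End K (K ⊗[ℚ] V)) (-1) : Set (K ⊗[ℚ] V))) := by
  constructor
  · simpa only [map_one] using eigenspace_glExtendScalars_eq_span_image_extendScalars K L V γ 1
  · simpa only [map_neg, map_one] using eigenspace_glExtendScalars_eq_span_image_extendScalars K L V γ (-1)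

omit [Module.Finite ℚ V] in
/-- **`j` maps `V_μ(γ)` into `V_μ(γ_L)` and NOTHING ELSE: `j x ∈ V_μ(γ_L) ⟺ x ∈ V_μ(γ)`** (`j` injective).
[cite: Milne1999LefschetzClasses, §1 Remark 1.6 (p. 644)] [cite: BourbakiAlgebraI1989, Ch. II §5 no. 3 Prop. 7] -/
theorem extendScalars_mem_eigenspace_glExtendScalars_iff (γ : (K ⊗[ℚ] V) ≃ₗ[K] (K ⊗[ℚ] V)) (μ : K) (x : K ⊗[ℚ] V) :
    extendScalars K L V x ∈ Module.End.eigenspace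
        ((glExtendScalars K L V γ : (L ⊗[ℚ] V) ≃ₗ[L] (L ⊗[ℚ] V)) : Module.End L (L ⊗[ℚ] V)) (algebraMap K L μ) ↔
      x ∈ Module.End.eigenspace ((γ : (K ⊗[ℚ] V) ≃ₗ[K] (K ⊗[ℚ] V)) : Module.End K (K ⊗[ℚ] V)) μ := by
  rw [Module.End.mem_eigenspace_iff, Module.End.mem_eigenspace_iff, coe_glExtendScalars_extendScalars,
    ← extendScalars_smul_eq_algebraMap_smul, (extendScalars_injective K L V).eq_iff]

end Kernels

namespace HodgeStructure

/-! ## §3 For the centre of `S(H)`: the sign blocks of a central `γ` base-change to those of `γ_L` -/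

section Centre

variable (K : Type u) (L : Type u') [Field K] [Field L] [Algebra ℚ K] [Algebra ℚ L] [Algebra K L]
  [IsScalarTower ℚ K L] {V : Type v} [AddCommGroup V] [Module ℚ V] [Module.Finite ℚ V] {n : ℤ} {H : HodgeStructure V n}
  (ψ : Polarization H)

/-- **THE SIGN BLOCKS `V_±(γ)` OF `γ ∈ S(H)(K)` BASE-CHANGE TO THE SIGN BLOCKS OF `γ_L ∈ S(H)(L)`**: `V_±(γ_L) = span_L j(V_±(γ))` — for
a central `γ` (acting on the canonical blocks by signs) this is Milne's «`V(A) = V₁ ⊕ ⋯ ⊕ V_t`, `V_i = e_i V`» read in `k ⊆ k'` for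
the action of `S₀` («together with their actions on `V(A)`», §2). [cite: Milne1999LefschetzClasses, §1 Remark 1.6 (p. 644), p. 645 L2–L6 and §2 p. 646 L33–L40] -/
theorem Polarization.eigenspace_glExtendScalars_one_neg_one_eq_span (γ : ψ.lefschetzGroupBaseChange K) :
    Module.End.eigenspace ((glExtendScalars K L V (γ : (K ⊗[ℚ] V) ≃ₗ[K] (K ⊗[ℚ] V)) : (L ⊗[ℚ] V) ≃ₗ[L] (L ⊗[ℚ] V)) :
        Module.End L (L ⊗[ℚ] V)) 1 =
      Submodule.span L (extendScalars K L V '' (Module.End.eigenspace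
        (((γ : (K ⊗[ℚ] V) ≃ₗ[K] (K ⊗[ℚ] V)) : Module.End K (K ⊗[ℚ] V))) 1 : Set (K ⊗[ℚ] V))) ∧
    Module.End.eigenspace ((glExtendScalars K L V (γ : (K ⊗[ℚ] V) ≃ₗ[K] (K ⊗[ℚ] V)) : (L ⊗[ℚ] V) ≃ₗ[L] (L ⊗[ℚ] V)) :
        Module.End L (L ⊗[ℚ] V)) (-1) =
      Submodule.span L (extendScalars K L V '' (Module.End.eigenspace
        (((γ : (K ⊗[ℚ] V) ≃ₗ[K] (K ⊗[ℚ] V)) : Module.End K (K ⊗[ℚ] V))) (-1) : Set (K ⊗[ℚ] V))) :=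
  eigenspace_glExtendScalars_one_neg_one K L V _

/-- **FIRST KIND, CENTRAL `γ`: THE BASE-CHANGED SIGN BLOCKS STILL SPLIT, `L ⊗ V = V₊(γ_L) ⊕ V₋(γ_L) = span_L j(V₊(γ)) ⊕ span_L j(V₋(γ))`**
(`γ_L` is central in `S(H)(L)`, g56-#2, and g55-#12 over `L`). [cite: Milne1999LefschetzClasses, §1 Remark 1.6 (p. 644), p. 645 L2–L6 and §2 p. 646 L33–L40]
[cite: MoonenZarhin1998WeilClasses, §1 Lemma (1)] -/
theorem Polarization.isCompl_span_image_extendScalars_eigenspace_of_mem_center {γ : ψ.lefschetzGroupBaseChange K}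
    (hγ : γ ∈ Subgroup.center (ψ.lefschetzGroupBaseChange K))
    (hfix : ∀ z : H.endAlg, z ∈ Subalgebra.center ℚ H.endAlg → ψ.adjoint (z : Module.End ℚ V) = z) :
    IsCompl
      (Submodule.span L (extendScalars K L V '' (Module.End.eigenspace
        (((γ : (K ⊗[ℚ] V) ≃ₗ[K] (K ⊗[ℚ] V)) : Module.End K (K ⊗[ℚ] V))) 1 : Set (K ⊗[ℚ] V))))
      (Submodule.span L (extendScalars K L V '' (Module.End.eigenspace
        (((γ : (K ⊗[ℚ] V) ≃ₗ[K] (K ⊗[ℚ] V)) : Module.End K (K ⊗[ℚ] V))) (-1) : Set (K ⊗[ℚ] V)))) := by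
  have h := ψ.isCompl_eigenspace_one_neg_one_of_mem_center_lefschetzGroupBaseChange L hfix
    (ψ.glExtendScalars_mem_center_lefschetzGroupBaseChange K L hγ)
  have h2 := ψ.eigenspace_glExtendScalars_one_neg_one_eq_span K L γ
  rw [h2.1, h2.2] at h
  exact h

end Centre

end HodgeStructure

end Literature.AlgebraicGeometry.Motives
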